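import Mathlib
import HarnessLib
import Summits.Ventures.LatticeQCDFlow.Scoring.ChainEDFBand
import Summits.Ventures.LatticeQCDFlow.Scoring.TwoSampleEDFBand

/-!
# TWO EXACT SAMPLERS, TWO INDEPENDENT RUNS, ANY STARTS: a finite-`N` uniform band for the
# DIFFERENCE of the two printed distribution functions of a statistic along two Doeblin chains
# with the same stationary law of the statistic

HONEST FRAMING: exact (Metropolis-corrected) sampling algorithms for lattice gauge theory;
figures of merit are autocorrelation/cost numbers at stated couplings and volumes; no
continuum-physics claim.

Venture `LatticeQCDFlow` (cell pub-lqcd), topic `Scoring`; FANOUT row 4 (`s0-u1-b`, rung S0-B: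
two independent implementations A and B of one card).  Row 4's two-sample band
`Scoring/TwoSampleEDFBand` compares the printed distribution functions of two INDEPENDENT iid
codes; the two arms of the row are exact Markov-chain samplers.  This file is the chain version,
assembled from the one-chain band
`Scoring/ChainEDFBand.chain_measureReal_exists_edf_dev_ge_le_of_pos` at accuracy `η/2` for each
run and the triangle step `TwoSampleEDFBand.abs_sub_lt_of_abs_sub_lt` on the product of the two
trajectory spaces: **`chain_measureReal_exists_twoSample_edf_dev_ge_le`** —
two Markov kernels `κ_A`, `κ_B` (possibly on different state spaces, different algorithms) with
invariant laws `π_A`, `π_B`, Doeblin constants `ε_A`, `ε_B`, measurable real statistics `O_A`, `O_B`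
with the SAME stationary law `π_A ∘ O_A⁻¹ = π_B ∘ O_B⁻¹`, run independently from arbitrary
initial laws for `N` and `M` steps (`Nη ≥ 32/ε_A`, `Mη ≥ 32/ε_B`):
`(P_A ⊗ P_B)(∃ t, η ≤ |F̂^A_N(t) − F̂^B_M(t)|)
   ≤ 2(⌈4/η⌉ + 1)·(exp(−(Nη − 32/ε_A)²/(512N/ε_A²)) + exp(−(Mη − 32/ε_B)²/(512M/ε_B²)))`.
No stationarity, no independence inside a run, no common state space; the supremum event is
handled through the outer measure.  NEW WORK of the cell (not a published result); no definition.

## Content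

* `measureReal_traj_prod_fst_eq`, `measureReal_traj_prod_snd_eq` — marginals of the product of
  the two trajectory laws (real form);
* **`chain_measureReal_exists_twoSample_edf_dev_ge_le`** — the two-chain band.

Reading (value-free): two certified Doeblin constants make "implementation A and implementation
B print the same distribution function of the statistic, uniformly within `η`" a finite-run
probability statement for two exact samplers started anywhere.  NOT CLAIMED: any `ε` for a
concrete sampler; the Kolmogorov–Smirnov limit law; reweighted proposal streams.
-/

noncomputable section

namespace Summit.Ventures.LatticeQCDFlow.Scoring.GlivenkoCantelli

open MeasureTheory ProbabilityTheory Finset Filter Function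
open scoped Topology ENNReal

variable {ΩA : Type*} [MeasurableSpace ΩA] {κA : Kernel ΩA ΩA} [IsMarkovKernel κA]
  {μA : Measure ΩA} [IsProbabilityMeasure μA] {πA : Measure ΩA} [IsProbabilityMeasure πA]
variable {ΩB : Type*} [MeasurableSpace ΩB] {κB : Kernel ΩB ΩB} [IsMarkovKernel κB]
  {μB : Measure ΩB} [IsProbabilityMeasure μB] {πB : Measure ΩB} [IsProbabilityMeasure πB]

/-- **THE TWO-CHAIN FINITE-RUN BAND.**  `π_A` invariant for `κ_A` with `κ_A(x, ·) ≥ ε_A π_A`,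
`π_B` invariant for `κ_B` with `κ_B(y, ·) ≥ ε_B π_B` (`ε_A, ε_B > 0`); measurable real statistics
`O_A`, `O_B` with the same stationary law `π_A ∘ O_A⁻¹ = π_B ∘ O_B⁻¹`; the two chains are run
independently (product of the two trajectory laws) from arbitrary initial laws `μ_A`, `μ_B`;
`η > 0`, `N, M ≠ 0`, `Nη ≥ 32/ε_A`, `Mη ≥ 32/ε_B`.  Then
`(P_A ⊗ P_B)(∃ t, η ≤ |#{i<N : O_A(X_i) ≤ t}/N − #{j<M : O_B(Y_j) ≤ t}/M|)
   ≤ 2(⌈4/η⌉ + 1)·(exp(−(Nη − 32/ε_A)²/(512N/ε_A²)) + exp(−(Mη − 32/ε_B)²/(512M/ε_B²)))`.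
[ours] -/
theorem chain_measureReal_exists_twoSample_edf_dev_ge_le
    (hπA : Kernel.Invariant κA πA) {εA : ℝ≥0∞}
    (hminA : ∀ x {B : Set ΩA}, MeasurableSet B → εA * πA B ≤ κA x B) (hεA : 0 < εA)
    {OA : ΩA → ℝ} (hOA : Measurable OA)
    (hπB : Kernel.Invariant κB πB) {εB : ℝ≥0∞}
    (hminB : ∀ y {B : Set ΩB}, MeasurableSet B → εB * πB B ≤ κB y B) (hεB : 0 < εB)
    {OB : ΩB → ℝ} (hOB : Measurable OB) (hlaw : πB.map OB = πA.map OA)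
    {η : ℝ} (hη : 0 < η) {N M : ℕ} (hN : N ≠ 0) (hM : M ≠ 0)
    (hNη : 32 / εA.toReal ≤ N * η) (hMη : 32 / εB.toReal ≤ M * η) :
    ((Kernel.trajMeasure (X := fun _ : ℕ => ΩA) μA
          (fun m : ℕ => κA.comap
            (fun y : (i : ↥(Finset.Iic m)) → ΩA => y ⟨m, Finset.mem_Iic.2 le_rfl⟩)
            (measurable_pi_apply _))).prod
      (Kernel.trajMeasure (X := fun _ : ℕ => ΩB) μB
          (fun m : ℕ => κB.comap
            (fun y : (i : ↥(Finset.Iic m)) → ΩB => y ⟨m, Finset.mem_Iic.2 le_rfl⟩)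
            (measurable_pi_apply _)))).real
        {ω : (ℕ → ΩA) × (ℕ → ΩB) | ∃ t : ℝ,
          η ≤ |(∑ i ∈ range N, (Set.Iic t).indicator (1 : ℝ → ℝ) (OA (ω.1 i))) / N
            - (∑ j ∈ range M, (Set.Iic t).indicator (1 : ℝ → ℝ) (OB (ω.2 j))) / M|}
      ≤ 2 * ((⌈4 / η⌉₊ : ℝ) + 1)
          * (Real.exp (-(N * η - 32 / εA.toReal) ^ 2 / (512 * N / εA.toReal ^ 2))
            + Real.exp (-(M * η - 32 / εB.toReal) ^ 2 / (512 * M / εB.toReal ^ 2))) := by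
  set PA := Kernel.trajMeasure (X := fun _ : ℕ => ΩA) μA
      (fun m : ℕ => κA.comap (fun y : (i : ↥(Finset.Iic m)) → ΩA => y ⟨m, Finset.mem_Iic.2 le_rfl⟩)
        (measurable_pi_apply _)) with hPA
  set PB := Kernel.trajMeasure (X := fun _ : ℕ => ΩB) μB
      (fun m : ℕ => κB.comap (fun y : (i : ↥(Finset.Iic m)) → ΩB => y ⟨m, Finset.mem_Iic.2 le_rfl⟩)
        (measurable_pi_apply _)) with hPB
  have hη2 : 0 < η / 2 := half_pos hη
  have hNη' : 16 / εA.toReal ≤ N * (η / 2) := by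
    have : (32 : ℝ) / εA.toReal = 2 * (16 / εA.toReal) := by ring
    linarith
  have hMη' : 16 / εB.toReal ≤ M * (η / 2) := by
    have : (32 : ℝ) / εB.toReal = 2 * (16 / εB.toReal) := by ring
    linarith
  have hA := chain_measureReal_exists_edf_dev_ge_le_of_pos (μ₀ := μA) hπA hminA hεA hOA hN hη2 hNη'
  have hB := chain_measureReal_exists_edf_dev_ge_le_of_pos (μ₀ := μB) hπB hminB hεB hOB hM hη2 hMη'
  rw [← hPA] at hA
  rw [← hPB, hlaw] at hB
  have e4 : (2 : ℝ) / (η / 2) = 4 / η := by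
    field_simp
    ring
  rw [e4] at hA hB
  -- the one-run deviation events
  set SA : Set (ℕ → ΩA) := {x | ∃ t : ℝ, η / 2 ≤ |cdf (πA.map OA) t
    - (∑ i ∈ range N, (Set.Iic t).indicator (1 : ℝ → ℝ) (OA (x i))) / N|} with hSA
  set SB : Set (ℕ → ΩB) := {y | ∃ t : ℝ, η / 2 ≤ |cdf (πA.map OA) t
    - (∑ j ∈ range M, (Set.Iic t).indicator (1 : ℝ → ℝ) (OB (y j))) / M|} with hSB
  have hsub : {ω : (ℕ → ΩA) × (ℕ → ΩB) | ∃ t : ℝ,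
      η ≤ |(∑ i ∈ range N, (Set.Iic t).indicator (1 : ℝ → ℝ) (OA (ω.1 i))) / N
        - (∑ j ∈ range M, (Set.Iic t).indicator (1 : ℝ → ℝ) (OB (ω.2 j))) / M|}
      ⊆ SA ×ˢ (Set.univ : Set (ℕ → ΩB)) ∪ (Set.univ : Set (ℕ → ΩA)) ×ˢ SB := by
    rintro ω ⟨t, ht⟩
    by_contra hgood
    simp only [Set.mem_union, Set.mem_prod, Set.mem_univ, and_true, true_and, not_or, hSA, hSB,
      Set.mem_setOf_eq, not_exists, not_le] at hgood
    have h1 := hgood.1 t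
    have h2 := hgood.2 t
    exact absurd ht (not_le.2 (abs_sub_lt_of_abs_sub_lt h1 h2))
  calc (PA.prod PB).real {ω : (ℕ → ΩA) × (ℕ → ΩB) | ∃ t : ℝ,
        η ≤ |(∑ i ∈ range N, (Set.Iic t).indicator (1 : ℝ → ℝ) (OA (ω.1 i))) / N
          - (∑ j ∈ range M, (Set.Iic t).indicator (1 : ℝ → ℝ) (OB (ω.2 j))) / M|}
      ≤ (PA.prod PB).real (SA ×ˢ (Set.univ : Set (ℕ → ΩB)) ∪ (Set.univ : Set (ℕ → ΩA)) ×ˢ SB) :=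
        measureReal_mono hsub (measure_ne_top _ _)
    _ ≤ (PA.prod PB).real (SA ×ˢ (Set.univ : Set (ℕ → ΩB)))
        + (PA.prod PB).real ((Set.univ : Set (ℕ → ΩA)) ×ˢ SB) := measureReal_union_le _ _
    _ = PA.real SA + PB.real SB := by
        simp only [measureReal_def, Measure.prod_prod, measure_univ, mul_one, one_mul]
    _ ≤ 2 * ((⌈4 / η⌉₊ : ℝ) + 1)
          * Real.exp (-(N * (η / 2) - 16 / εA.toReal) ^ 2 / (128 * N / εA.toReal ^ 2))
        + 2 * ((⌈4 / η⌉₊ : ℝ) + 1)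
          * Real.exp (-(M * (η / 2) - 16 / εB.toReal) ^ 2 / (128 * M / εB.toReal ^ 2)) :=
        add_le_add hA hB
    _ = 2 * ((⌈4 / η⌉₊ : ℝ) + 1)
          * (Real.exp (-(N * η - 32 / εA.toReal) ^ 2 / (512 * N / εA.toReal ^ 2))
            + Real.exp (-(M * η - 32 / εB.toReal) ^ 2 / (512 * M / εB.toReal ^ 2))) := by
        have en : -((N : ℝ) * (η / 2) - 16 / εA.toReal) ^ 2 / (128 * N / εA.toReal ^ 2)
            = -(N * η - 32 / εA.toReal) ^ 2 / (512 * N / εA.toReal ^ 2) := by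
          obtain ⟨-, -, -, -, -, heA⟩ := half_const_bounds hminA hεA
          have hNr : (0 : ℝ) < N := by exact_mod_cast Nat.pos_of_ne_zero hN
          field_simp
          ring
        have em : -((M : ℝ) * (η / 2) - 16 / εB.toReal) ^ 2 / (128 * M / εB.toReal ^ 2)
            = -(M * η - 32 / εB.toReal) ^ 2 / (512 * M / εB.toReal ^ 2) := by
          obtain ⟨-, -, -, -, -, heB⟩ := half_const_bounds hminB hεB
          have hMr : (0 : ℝ) < M := by exact_mod_cast Nat.pos_of_ne_zero hM
          field_simp
          ring
        rw [en, em]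
        ring

end Summit.Ventures.LatticeQCDFlow.Scoring.GlivenkoCantelli

end
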